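import Summits.QuantumFields.QCD.Theses.NestedDissectionSea
import Literature.MathematicalPhysics.QuantumFieldTheory.QCDPhaseQuenched
import Literature.MathematicalPhysics.QuantumFieldTheory.QCDPhaseQuenchedReweighting

/-!
# Stub `stub_signMobility` of line `mass-wegner-cell-index` (crux `NegativeCellsDilute`,
# stmt-QuantumFields-13900): the SIGN–MOBILITY IDENTITY for block heat-bath resampling

For the phase-quenched lattice-QCD measure `pq = qcdLatticeMeasure N β mq` on `SU(3)` gauge fields
of the four-torus, the `±1` observable `σ(U)` (sign of `Re det D_W(U, μp, 1)`), the full weight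
`w(U) = e^{−β S_W(U)} ∏_f |det D_W(U, m_f, 1)|`, the refit `r U V` (links of `B` from `V`, the rest
from `U`) and the flip propensity `m_B(U) = ∫ 1{σ(r U V) ≠ σ(U)} w(r U V) dV / ∫ w(r U V) dV`
(product Haar in `V`, `x / 0 = 0`), we prove: `m_B` is measurable, `0 ≤ m_B ≤ 1`, and
`∫ σ m_B d(pq) = 0`.

## Proof

* Abstract core (`signMobility_core`): on a measurable space `X` with a finite measure `π` and a
  "refit" `r : X → X → X` with `r (r U V) (r V U) = U`, `r (r U V) W = r U W`, jointly measurable,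
  and such that the swap `Φ(U, V) = (r U V, r V U)` preserves `π ⊗ π`, for measurable `σ = ±1` and
  measurable bounded `w ≥ 0`: with `Z(U) = ∫ w(r U V) dπ(V)` and
  `F(U, V) = σ(U) 1{σ(rUV) ≠ σ(U)} w(rUV) w(U) / Z(U)` one has `σ m_B w (U) = ∫ F(U, V) dπ(V)`,
  `F ∘ Φ = −F` (on the event the two signs are opposite; `Z (r U V) = Z U`), `F` is
  `π ⊗ π`-integrable (Tonelli: `∫ |F(U, ·)| = m_B(U) w(U) ≤ w(U) ≤ C`), hence by Fubini and the
  measure-preserving involution `∫ σ m_B w dπ = ∫ F d(π ⊗ π) = −∫ F d(π ⊗ π) = 0`.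
* The swap preserves `π ⊗ π` for `π = Measure.pi (fun _ : E => μ)`
  (`signMobility_measurePreserving_swap`): through `MeasurableEquiv.arrowProdEquivProdArrow`
  (measure-preserving between `Measure.pi (fun _ => μ.prod μ)` and `π.prod π`) it is the
  coordinatewise map "`Prod.swap` on the coordinates in `B`, identity elsewhere", which preserves
  `Measure.pi (fun _ => μ.prod μ)` (`measurePreserving_pi`, `measurePreserving_swap`).
* Instantiation: `X = GaugeConfig 4 N SU(3)`, `μ = haarProbability SU(3)`; `σ` is measurable as
  `U ↦ Re det D_W(U)` is continuous (`continuous_wilsonDirac`), `w` is continuous (hence bounded on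
  the compact configuration space), and
  `qcdLatticeMeasure = c • (π.withDensity e^{−β S_W}).withDensity (∏ |det|)`, so
  `∫ σ m_B d(pq) = c.toReal • ∫ σ m_B w dπ = 0`.
-/

noncomputable section

namespace Summit.QuantumFields.QCD.Cruxes.NegativeCellsDilute.MassWegnerCellIndex

open scoped BigOperators ENNReal Classical
open MeasureTheory Filter
open Literature.MathematicalPhysics.QuantumLattice Literature.MathematicalPhysics.QuantumFieldTheory
  Literature.Probability.LatticeModels

/-! ### Abstract lemmas -/

section Abstract

variable {X : Type*} [MeasurableSpace X]

/-- If `Φ` preserves `ν` and `F ∘ Φ = -F` pointwise, then `∫ F dν = 0`. -/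
private theorem signMobility_integral_eq_zero_of_antisymm {ν : Measure X} {Φ : X → X}
    (hΦ : MeasurePreserving Φ ν ν) {F : X → ℝ} (hanti : ∀ x, F (Φ x) = -F x) :
    ∫ x, F x ∂ν = 0 := by
  by_cases hF : AEStronglyMeasurable F ν
  · have h1 : ∫ x, F (Φ x) ∂ν = ∫ x, F x ∂ν := by
      rw [← integral_map hΦ.measurable.aemeasurable (by rw [hΦ.map_eq]; exact hF), hΦ.map_eq]
    have h2 : ∫ x, F (Φ x) ∂ν = -∫ x, F x ∂ν := by
      simp_rw [hanti]
      exact integral_neg F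
    linarith
  · exact integral_non_aestronglyMeasurable hF

/-- **Abstract sign–mobility identity.** For a finite measure `π`, a jointly measurable refit `r`
with `r (r U V) (r V U) = U`, `r (r U V) W = r U W` whose swap `(U, V) ↦ (r U V, r V U)` preserves
`π ⊗ π`, a measurable `±1`-valued `σ` and a measurable bounded `w ≥ 0`: the flip propensity
`num / Z` is measurable, lies in `[0, 1]`, and `∫ σ · (num / Z) · w dπ = 0`. -/
private theorem signMobility_core {π : Measure X} [IsFiniteMeasure π] {r : X → X → X}
    {σ w : X → ℝ} {C : ℝ} (hr : Measurable fun q : X × X => r q.1 q.2)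
    (hr2 : ∀ U V, r (r U V) (r V U) = U) (hr3 : ∀ U V W, r (r U V) W = r U W)
    (hΦ : MeasurePreserving (fun q : X × X => (r q.1 q.2, r q.2 q.1)) (π.prod π) (π.prod π))
    (hσ : Measurable σ) (hσ1 : ∀ U, σ U = 1 ∨ σ U = -1) (hw : Measurable w)
    (hw0 : ∀ U, 0 ≤ w U) (hwC : ∀ U, w U ≤ C) (ind : X → X → ℝ)
    (hind : ind = fun U V => if σ (r U V) ≠ σ U then (1 : ℝ) else 0) (num Z : X → ℝ)
    (hnum : num = fun U => ∫ V, ind U V * w (r U V) ∂π) (hZ : Z = fun U => ∫ V, w (r U V) ∂π) :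
    Measurable (fun U => num U / Z U) ∧ (∀ U, 0 ≤ num U / Z U ∧ num U / Z U ≤ 1) ∧
      ∫ U, σ U * (num U / Z U) * w U ∂π = 0 := by
  -- pointwise equations
  have hind' : ∀ U V, ind U V = if σ (r U V) ≠ σ U then (1 : ℝ) else 0 := fun U V => by rw [hind]
  have hnum' : ∀ U, num U = ∫ V, ind U V * w (r U V) ∂π := fun U => by rw [hnum]
  have hZ' : ∀ U, Z U = ∫ V, w (r U V) ∂π := fun U => by rw [hZ]
  -- sign flips
  have hflip : ∀ a b : X, σ a ≠ σ b → σ a = -σ b := by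
    intro a b h
    rcases hσ1 a with ha | ha <;> rcases hσ1 b with hb | hb
    · exact absurd (ha.trans hb.symm) h
    · norm_num [ha, hb]
    · norm_num [ha, hb]
    · exact absurd (ha.trans hb.symm) h
  -- the indicator
  have hind01 : ∀ U V, 0 ≤ ind U V ∧ ind U V ≤ 1 := fun U V => by
    rw [hind']; split_ifs <;> norm_num
  have hindm : Measurable fun q : X × X => ind q.1 q.2 := by
    rw [hind]
    exact Measurable.ite (measurableSet_eq_fun (hσ.comp hr) (hσ.comp measurable_fst)).compl
      measurable_const measurable_const
  -- the integrands
  have hwr : Measurable fun q : X × X => w (r q.1 q.2) := hw.comp hr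
  have hg : Measurable fun q : X × X => ind q.1 q.2 * w (r q.1 q.2) := hindm.mul hwr
  have hgU : ∀ U, Measurable fun V => ind U V * w (r U V) := fun U =>
    hg.comp measurable_prodMk_left
  have hwU : ∀ U, Measurable fun V => w (r U V) := fun U => hwr.comp measurable_prodMk_left
  have hg0 : ∀ U V, 0 ≤ ind U V * w (r U V) := fun U V => mul_nonneg (hind01 U V).1 (hw0 _)
  have hgw : ∀ U V, ind U V * w (r U V) ≤ w (r U V) := fun U V => by
    have := mul_le_mul_of_nonneg_right (hind01 U V).2 (hw0 (r U V))
    rwa [one_mul] at this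
  have hwU_int : ∀ U, Integrable (fun V => w (r U V)) π := fun U =>
    Integrable.of_bound (hwU U).aestronglyMeasurable C (ae_of_all _ fun V => by
      rw [Real.norm_of_nonneg (hw0 _)]; exact hwC _)
  have hgU_int : ∀ U, Integrable (fun V => ind U V * w (r U V)) π := fun U =>
    Integrable.of_bound (hgU U).aestronglyMeasurable C (ae_of_all _ fun V => by
      rw [Real.norm_of_nonneg (hg0 U V)]; exact (hgw U V).trans (hwC _))
  -- `num`, `Z`
  have hnum0 : ∀ U, 0 ≤ num U := fun U => by rw [hnum']; exact integral_nonneg (hg0 U)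
  have hZ0 : ∀ U, 0 ≤ Z U := fun U => by rw [hZ']; exact integral_nonneg fun V => hw0 _
  have hnumZ : ∀ U, num U ≤ Z U := fun U => by
    rw [hnum', hZ']; exact integral_mono (hgU_int U) (hwU_int U) (hgw U)
  have hm01 : ∀ U, 0 ≤ num U / Z U ∧ num U / Z U ≤ 1 := fun U =>
    ⟨div_nonneg (hnum0 U) (hZ0 U), div_le_one_of_le₀ (hnumZ U) (hZ0 U)⟩
  have hnum_m : Measurable num := by
    rw [hnum]; exact (hg.stronglyMeasurable.integral_prod_right' (ν := π)).measurable
  have hZ_m : Measurable Z := by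
    rw [hZ]; exact (hwr.stronglyMeasurable.integral_prod_right' (ν := π)).measurable
  refine ⟨hnum_m.div hZ_m, hm01, ?_⟩
  -- the identity: `Z` is refit-invariant
  have hZr : ∀ U V, Z (r U V) = Z U := fun U V => by simp only [hZ', hr3]
  -- the two-variable integrand
  set F : X × X → ℝ := fun q => σ q.1 * (ind q.1 q.2 * w (r q.1 q.2)) * (w q.1 / Z q.1) with hF
  have hFm : Measurable F :=
    ((hσ.comp measurable_fst).mul hg).mul ((hw.comp measurable_fst).div (hZ_m.comp measurable_fst))
  have hFU_int : ∀ U, ∫ V, F (U, V) ∂π = σ U * (num U / Z U) * w U := fun U => by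
    simp only [hF]
    rw [integral_mul_const, integral_const_mul, ← hnum']
    ring
  have hnormF : ∀ U V, ‖F (U, V)‖ = ind U V * w (r U V) * (w U / Z U) := fun U V => by
    have h1 : ‖σ U‖ = 1 := by rcases hσ1 U with h | h <;> simp [h]
    simp only [hF, norm_mul, Real.norm_of_nonneg (hg0 U V),
      Real.norm_of_nonneg (div_nonneg (hw0 U) (hZ0 U)), h1, one_mul]
  have hnormF_int : ∀ U, ∫ V, ‖F (U, V)‖ ∂π = num U / Z U * w U := fun U => by
    simp_rw [hnormF]
    rw [integral_mul_const, ← hnum']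
    ring
  have hF_int : Integrable F (π.prod π) := by
    refine (integrable_prod_iff hFm.aestronglyMeasurable).2 ⟨ae_of_all _ fun U => ?_, ?_⟩
    · exact ((hgU_int U).const_mul (σ U)).mul_const (w U / Z U)
    · refine Integrable.of_bound
        (hFm.stronglyMeasurable.norm.integral_prod_right' (ν := π)).aestronglyMeasurable C
        (ae_of_all _ fun U => ?_)
      rw [hnormF_int, Real.norm_of_nonneg (mul_nonneg (hm01 U).1 (hw0 U))]
      calc num U / Z U * w U ≤ 1 * w U := mul_le_mul_of_nonneg_right (hm01 U).2 (hw0 U)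
        _ = w U := one_mul _
        _ ≤ C := hwC U
  -- antisymmetry under the swap
  have hanti : ∀ q, F ((fun q : X × X => (r q.1 q.2, r q.2 q.1)) q) = -F q := by
    rintro ⟨U, V⟩
    simp only [hF, hr2, hZr, hind']
    split_ifs with h1 h2 h2
    · rw [hflip _ _ h2]; ring
    · exact (h2 (Ne.symm h1)).elim
    · exact (h1 (Ne.symm h2)).elim
    · ring
  -- assemble
  calc ∫ U, σ U * (num U / Z U) * w U ∂π = ∫ U, ∫ V, F (U, V) ∂π ∂π := by simp_rw [hFU_int]
    _ = ∫ q, F q ∂(π.prod π) := (integral_prod F hF_int).symm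
    _ = 0 := signMobility_integral_eq_zero_of_antisymm hΦ hanti

end Abstract

/-! ### The refit on a product of identical factors -/

section Pi

variable {E : Type*} [Fintype E] {G : Type*} [MeasurableSpace G]

omit [Fintype E] in
/-- The refit `(U, V) ↦ (e ↦ if p e then V e else U e)` is jointly measurable. -/
private theorem signMobility_measurable_refit (p : E → Prop) [DecidablePred p] :
    Measurable fun q : (E → G) × (E → G) => fun e => if p e then q.2 e else q.1 e := by
  refine measurable_pi_lambda _ fun e => ?_
  by_cases he : p e
  · simp only [he, if_true]
    exact (measurable_pi_apply e).comp measurable_snd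
  · simp only [he, if_false]
    exact (measurable_pi_apply e).comp measurable_fst

/-- The swap of the `p`-coordinates of two independent copies of `Measure.pi (fun _ : E => μ)`
preserves the product measure. -/
private theorem signMobility_measurePreserving_swap (μ : Measure G) [SigmaFinite μ]
    (p : E → Prop) [DecidablePred p] :
    MeasurePreserving
      (fun q : (E → G) × (E → G) =>
        ((fun e => if p e then q.2 e else q.1 e), (fun e => if p e then q.1 e else q.2 e)))
      ((Measure.pi fun _ : E => μ).prod (Measure.pi fun _ : E => μ))
      ((Measure.pi fun _ : E => μ).prod (Measure.pi fun _ : E => μ)) := by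
  have hA := measurePreserving_arrowProdEquivProdArrow G G E (fun _ => μ) (fun _ => μ)
  have hT : MeasurePreserving
      (fun (a : E → G × G) (e : E) => (if p e then (Prod.swap : G × G → G × G) else id) (a e))
      (Measure.pi fun _ : E => μ.prod μ) (Measure.pi fun _ : E => μ.prod μ) :=
    measurePreserving_pi (f := fun e => if p e then (Prod.swap : G × G → G × G) else id)
      (fun _ : E => μ.prod μ) (fun _ : E => μ.prod μ) fun e => by
      show MeasurePreserving (if p e then (Prod.swap : G × G → G × G) else id) (μ.prod μ) (μ.prod μ)
      split_ifs
      · exact Measure.measurePreserving_swap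
      · exact MeasurePreserving.id _
  have heq : (fun q : (E → G) × (E → G) =>
        ((fun e => if p e then q.2 e else q.1 e), (fun e => if p e then q.1 e else q.2 e))) =
      (MeasurableEquiv.arrowProdEquivProdArrow G G E) ∘
        ((fun (a : E → G × G) (e : E) => (if p e then (Prod.swap : G × G → G × G) else id) (a e)) ∘
          (MeasurableEquiv.arrowProdEquivProdArrow G G E).symm) := by
    funext q
    refine Prod.ext (funext fun e => ?_) (funext fun e => ?_)
    · show (if p e then q.2 e else q.1 e) =
        ((if p e then (Prod.swap : G × G → G × G) else id) (q.1 e, q.2 e)).1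
      split_ifs <;> rfl
    · show (if p e then q.1 e else q.2 e) =
        ((if p e then (Prod.swap : G × G → G × G) else id) (q.1 e, q.2 e)).2
      split_ifs <;> rfl
  rw [heq]
  exact hA.comp (hT.comp (hA.symm _))

end Pi

/-! ### The stub -/

/-- **Stub 3a — `signMobility` (SIGN–MOBILITY IDENTITY for block heat-bath resampling).**
On every torus, for every coupling `β`, mass tuple `mq`, probe mass `μp` and every finite link set
`B`: with the sign `σ(U) = ±1` of `Re det D_W(U, μp, 1)`, the full phase-quenched weight
`w(U) = e^{−β S_W(U)} ∏_f |det D_W(U, m_f, 1)|`, the refit `r U V` (links of `B` from `V`, the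
rest from `U`) and the flip propensity
`m_B(U) = ∫ 1{σ(r U V) ≠ σ(U)} w(r U V) dV / ∫ w(r U V) dV` (product Haar in `V`; `x/0 = 0`),
the function `m_B` is measurable, takes values in `[0, 1]`, and is orthogonal to the sign under
the phase-quenched measure: `∫ σ m_B d(qcdLatticeMeasure N β mq) = 0` (heat-bath stationarity /
antisymmetry of the double integral under swapping old and new interiors). -/
theorem stub_signMobility :
    ∀ (N : ℕ) [NeZero N] (Nf : ℕ) (β : ℝ) (mq : Fin Nf → ℝ) (μp : ℝ) (B : Finset (Edge 4 N)),
      let σ : GaugeConfig 4 N SU3 → ℝ := fun U =>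
        if (fermionDet (wilsonDirac (fundamentalRep (Fin 3)) U μp 1)).re < 0 then -1 else 1
      let w : GaugeConfig 4 N SU3 → ℝ := fun U =>
        Real.exp (-(β * wilsonAction (fundamentalRep (Fin 3)) U)) *
          ∏ f, ‖fermionDet (wilsonDirac (fundamentalRep (Fin 3)) U (mq f) 1)‖
      let r : GaugeConfig 4 N SU3 → GaugeConfig 4 N SU3 → GaugeConfig 4 N SU3 := fun U V e =>
        if e ∈ B then V e else U e
      let mB : GaugeConfig 4 N SU3 → ℝ := fun U =>
        (∫ V, (if σ (r U V) ≠ σ U then (1 : ℝ) else 0) * w (r U V)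
            ∂(Measure.pi fun _ : Edge 4 N => haarProbability SU3)) /
          (∫ V, w (r U V) ∂(Measure.pi fun _ : Edge 4 N => haarProbability SU3))
      Measurable mB ∧ (∀ U, 0 ≤ mB U ∧ mB U ≤ 1) ∧
        ∫ U, σ U * mB U ∂(qcdLatticeMeasure N β mq) = 0 := by
  intro N _ Nf β mq μp B σ w r mB
  have hρ := continuous_fundamentalRep (Fin 3)
  -- the sign
  have hdet : ∀ m : ℝ, Continuous fun U : GaugeConfig 4 N SU3 =>
      fermionDet (wilsonDirac (fundamentalRep (Fin 3)) U m 1) := fun m =>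
    (continuous_wilsonDirac (fundamentalRep (Fin 3)) hρ m 1).matrix_det
  have hσm : Measurable σ := by
    refine Measurable.ite ?_ measurable_const measurable_const
    exact measurableSet_lt (Complex.continuous_re.comp (hdet μp)).measurable measurable_const
  have hσ1 : ∀ U, σ U = 1 ∨ σ U = -1 := fun U => by
    simp only [σ]
    split_ifs <;> norm_num
  -- the weight
  have hS : Continuous fun U : GaugeConfig 4 N SU3 => wilsonAction (fundamentalRep (Fin 3)) U := by
    unfold wilsonAction
    refine continuous_finsetSum _ fun P _ => continuous_const.sub ?_
    refine (continuous_trace_re (fundamentalRep (Fin 3)) hρ).comp ?_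
    unfold plaquetteHolonomy
    fun_prop
  have hwc : Continuous w := by
    refine (Real.continuous_exp.comp ?_).mul (continuous_finsetProd _ fun f _ => (hdet (mq f)).norm)
    exact (continuous_const.mul hS).neg
  obtain ⟨C, hC⟩ : ∃ C : ℝ, ∀ U, w U ≤ C := by
    obtain ⟨C, hC⟩ := isCompact_univ.exists_bound_of_continuousOn hwc.continuousOn
    exact ⟨C, fun U => (le_abs_self (w U)).trans
      (by simpa only [Real.norm_eq_abs] using hC U (Set.mem_univ U))⟩
  have hw0 : ∀ U, 0 ≤ w U := fun U =>
    mul_nonneg (Real.exp_pos _).le (Finset.prod_nonneg fun f _ => norm_nonneg _)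
  -- the refit
  have hr : Measurable fun q : GaugeConfig 4 N SU3 × GaugeConfig 4 N SU3 => r q.1 q.2 :=
    signMobility_measurable_refit (G := SU3) (· ∈ B)
  have hr2 : ∀ U V, r (r U V) (r V U) = U := fun U V => by
    funext e
    simp only [r]
    split_ifs <;> rfl
  have hr3 : ∀ U V W, r (r U V) W = r U W := fun U V W => by
    funext e
    simp only [r]
    split_ifs <;> rfl
  have hΦ : MeasurePreserving
      (fun q : GaugeConfig 4 N SU3 × GaugeConfig 4 N SU3 => (r q.1 q.2, r q.2 q.1))
      ((Measure.pi fun _ : Edge 4 N => haarProbability SU3).prod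
        (Measure.pi fun _ : Edge 4 N => haarProbability SU3))
      ((Measure.pi fun _ : Edge 4 N => haarProbability SU3).prod
        (Measure.pi fun _ : Edge 4 N => haarProbability SU3)) :=
    signMobility_measurePreserving_swap (haarProbability SU3) (· ∈ B)
  -- the abstract core
  have core := signMobility_core hr hr2 hr3 hΦ hσm hσ1 hwc.measurable hw0 hC _ rfl _ _ rfl rfl
  refine ⟨core.1, core.2.1, ?_⟩
  have key : ∫ U, σ U * mB U * w U ∂(Measure.pi fun _ : Edge 4 N => haarProbability SU3) = 0 :=
    core.2.2
  -- from the phase-quenched measure to product Haar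
  have hprod_m : Measurable fun U : GaugeConfig 4 N SU3 =>
      ∏ f, ‖fermionDet (wilsonDirac (fundamentalRep (Fin 3)) U (mq f) 1)‖ :=
    (continuous_finsetProd _ fun f _ => (hdet (mq f)).norm).measurable
  have hexp_m : Measurable fun U : GaugeConfig 4 N SU3 =>
      Real.exp (-β * wilsonAction (fundamentalRep (Fin 3)) U) :=
    (Real.continuous_exp.comp (continuous_const.mul hS)).measurable
  rw [qcdLatticeMeasure, integral_smul_measure, qcdLatticeWeight,
    integral_withDensity_eq_integral_toReal_smul hprod_m.ennreal_ofReal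
      (ae_of_all _ fun _ => ENNReal.ofReal_lt_top),
    wilsonWeight,
    integral_withDensity_eq_integral_toReal_smul hexp_m.ennreal_ofReal
      (ae_of_all _ fun _ => ENNReal.ofReal_lt_top)]
  refine smul_eq_zero_of_right _ ?_
  refine (integral_congr_ae (ae_of_all _ fun U => ?_)).trans key
  rw [ENNReal.toReal_ofReal (Real.exp_pos _).le,
    ENNReal.toReal_ofReal (Finset.prod_nonneg fun f _ => norm_nonneg _), smul_eq_mul, smul_eq_mul]
  simp only [w, neg_mul]
  ring

end Summit.QuantumFields.QCD.Cruxes.NegativeCellsDilute.MassWegnerCellIndex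

end
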